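import Literature.NumberTheory.NumberFields.RescaledCompletion
import Literature.NumberTheory.GaloisRepresentations.PadicAlgebraDegreeOnePlace
import HarnessLib

/-!
# `𝒪_v ≃+* ℤ_p` at a place of degree one: the canonical `ℚ_p → F_v` (bijective when
# `e(v|p) = f(v|p) = 1`) matches the valuation rings — de Shalit's «`𝒪_𝔭 = ℤ_p`» at a split prime

For a number field `F`, a prime `p` and a place `v ∣ p`, the tree has THE canonical continuous
`ℚ_p`-algebra structure `ℚ_p → F_v` (`LocalField.adicCompletionPadicAlgebra`), its degree
`[F_v : ℚ_p] = e_v f_v` (`finrank_adicCompletionPadicAlgebra_eq`), its norm law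
`‖algebraMap c‖_v = |c|_p^{e_v f_v}` (`RescaledCompletion.norm_algebraMap_adicCompletion`), and its
BIJECTIVITY at a place of degree one (`LocalField.bijective_algebraMap_adicCompletionPadicAlgebra`; for a
quadratic field and a split `p`: `…_of_split`). What the `p`-adic measure side and the Lubin–Tate/Coleman
lane consume is a ring isomorphism of the INTEGERS, `e : 𝒪_v ≃+* ℤ_p` (the hypothesis `e` of
`RayClassFieldAdicCharacterTower.lean`, `LubinTateTowerCharacterCells.lean`, …: de Shalit 1987 II.1.1
"`p` splits, `𝒪_𝔭 = ℤ_p`", I.3.3 "`κ : G ≃ ℤ_p^×`"). THIS FILE supplies it: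

* `LocalField.algebraMap_mem_adicCompletionIntegers_iff` — **`algebraMap c ∈ 𝒪_v ↔ ‖c‖ ≤ 1`** for every
  place `v ∣ p` (the norm law; no degree hypothesis);
* ★ `LocalField.adicCompletionIntegersEquivPadicInt` — for `ℚ_p → F_v` bijective: **`𝒪_v ≃+* ℤ_p`**, the
  inverse of the canonical map restricted to the integers (`coe_adicCompletionIntegersEquivPadicInt_symm_apply`:
  `e⁻¹ c = algebraMap c`); `…_of_degree_one` (`e(v|p) = f(v|p) = 1`), ★ `…_of_split` (quadratic `F`,
  two distinct places above `p` — the split prime of an imaginary quadratic field, e.g. `2` in `ℚ(√−7)`).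

Definitions with body + theorems; no named facts, no instances, no `sorry`.

## References

* [deShalit1987] E. de Shalit, *Iwasawa theory of elliptic curves with complex multiplication* (1987),
  II.1.1 (p. 32), I.3.3 (p. 17–18).
* [NeukirchANT1999] J. Neukirch, *Algebraic Number Theory* (1999), Ch. II Prop. (6.8), Thm. (4.8).
-/

noncomputable section

open NumberField IsDedekindDomain

namespace Literature.NumberTheory.GaloisRepresentations

namespace LocalField

variable {F : Type} [Field F] [NumberField F] (p : ℕ) [Fact p.Prime] (v : HeightOneSpectrum (𝓞 F))
  (hv : ((p : ℕ) : 𝓞 F) ∈ v.asIdeal)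

/-- **`algebraMap c ∈ 𝒪_v ↔ ‖c‖ ≤ 1`** for the canonical `ℚ_p → F_v` at any place `v ∣ p`:
`‖algebraMap c‖_v = |c|_p^{e_v f_v}` with `e_v f_v ≥ 1`, and `𝒪_v = {‖·‖_v ≤ 1}`.
[cite: NeukirchANT1999, Ch. II Thm. (4.8), Prop. (6.8)] [cite: deShalit1987, II.1.1 (p. 32)] -/
theorem algebraMap_mem_adicCompletionIntegers_iff (c : ℚ_[p]) :
    letI := adicCompletionPadicAlgebra v p hv
    algebraMap ℚ_[p] (v.adicCompletion F) c ∈ v.adicCompletionIntegers F ↔ ‖c‖ ≤ 1 := by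
  letI := adicCompletionPadicAlgebra v p hv
  have hnorm := Literature.NumberTheory.NumberFields.RescaledCompletion.norm_algebraMap_adicCompletion F p v hv c
  rw [HeightOneSpectrum.mem_adicCompletionIntegers, ← Valued.toNormedField.norm_le_one_iff,
    show ‖algebraMap ℚ_[p] (v.adicCompletion F) c‖ = ‖c‖ ^ Literature.NumberTheory.NumberFields.localDeg F v
      from hnorm]
  exact pow_le_one_iff_of_nonneg (norm_nonneg c) (Literature.NumberTheory.NumberFields.localDeg_pos F v).ne'

/-- ★ **`𝒪_v ≃+* ℤ_p` when the canonical `ℚ_p → F_v` is bijective** (a place of degree one): the inverse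
of `algebraMap ℚ_p F_v` restricted to the valuation rings (`algebraMap c ∈ 𝒪_v ↔ c ∈ ℤ_p`). De Shalit's
«`𝒪_𝔭 = ℤ_p`» at a split prime, as the ring isomorphism `e` the measure side / Lubin–Tate lane take as
input. [cite: deShalit1987, II.1.1 (p. 32), I.3.3 (p. 17–18)] [cite: NeukirchANT1999, Ch. II Prop. (6.8)] -/
def adicCompletionIntegersEquivPadicInt
    (hbij : letI := adicCompletionPadicAlgebra v p hv
      Function.Bijective (algebraMap ℚ_[p] (v.adicCompletion F))) :
    v.adicCompletionIntegers F ≃+* ℤ_[p] :=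
  letI := adicCompletionPadicAlgebra v p hv
  let Φ : ℚ_[p] ≃+* v.adicCompletion F := RingEquiv.ofBijective (algebraMap ℚ_[p] (v.adicCompletion F)) hbij
  { toFun := fun x ↦ ⟨Φ.symm (x : v.adicCompletion F),
      (algebraMap_mem_adicCompletionIntegers_iff p v hv _).mp (by
        rw [show algebraMap ℚ_[p] (v.adicCompletion F) (Φ.symm (x : v.adicCompletion F)) =
          Φ (Φ.symm (x : v.adicCompletion F)) from rfl, RingEquiv.apply_symm_apply]
        exact x.2)⟩
    invFun := fun c ↦ ⟨algebraMap ℚ_[p] (v.adicCompletion F) (c : ℚ_[p]),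
      (algebraMap_mem_adicCompletionIntegers_iff p v hv _).mpr c.2⟩
    left_inv := fun x ↦ Subtype.ext (by
      change Φ (Φ.symm (x : v.adicCompletion F)) = x
      exact RingEquiv.apply_symm_apply Φ _)
    right_inv := fun c ↦ PadicInt.ext (by
      change Φ.symm (Φ (c : ℚ_[p])) = c
      exact RingEquiv.symm_apply_apply Φ _)
    map_mul' := fun x y ↦ PadicInt.ext (by
      change Φ.symm ((x : v.adicCompletion F) * (y : v.adicCompletion F)) =
        Φ.symm (x : v.adicCompletion F) * Φ.symm (y : v.adicCompletion F)
      exact map_mul Φ.symm _ _)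
    map_add' := fun x y ↦ PadicInt.ext (by
      change Φ.symm ((x : v.adicCompletion F) + (y : v.adicCompletion F)) =
        Φ.symm (x : v.adicCompletion F) + Φ.symm (y : v.adicCompletion F)
      exact map_add Φ.symm _ _) }

/-- The inverse of `𝒪_v ≃+* ℤ_p` is the canonical map: `e⁻¹ c = algebraMap ℚ_p F_v c` in `F_v`.
[cite: deShalit1987, II.1.1 (p. 32)] -/
theorem coe_adicCompletionIntegersEquivPadicInt_symm_apply
    (hbij : letI := adicCompletionPadicAlgebra v p hv
      Function.Bijective (algebraMap ℚ_[p] (v.adicCompletion F))) (c : ℤ_[p]) :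
    (((adicCompletionIntegersEquivPadicInt p v hv hbij).symm c : v.adicCompletionIntegers F) :
        v.adicCompletion F) =
      (letI := adicCompletionPadicAlgebra v p hv; algebraMap ℚ_[p] (v.adicCompletion F) (c : ℚ_[p])) :=
  rfl

/-- And `algebraMap (e x) = x`: the canonical map sends `e x ∈ ℤ_p` back to `x ∈ 𝒪_v`.
[cite: deShalit1987, II.1.1 (p. 32)] -/
theorem algebraMap_adicCompletionIntegersEquivPadicInt_apply
    (hbij : letI := adicCompletionPadicAlgebra v p hv
      Function.Bijective (algebraMap ℚ_[p] (v.adicCompletion F))) (x : v.adicCompletionIntegers F) :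
    (letI := adicCompletionPadicAlgebra v p hv;
      algebraMap ℚ_[p] (v.adicCompletion F) ((adicCompletionIntegersEquivPadicInt p v hv hbij x : ℤ_[p]) : ℚ_[p])) =
      (x : v.adicCompletion F) := by
  have h := coe_adicCompletionIntegersEquivPadicInt_symm_apply p v hv hbij
    (adicCompletionIntegersEquivPadicInt p v hv hbij x)
  rw [RingEquiv.symm_apply_apply] at h
  exact h.symm

/-- ★ **`𝒪_v ≃+* ℤ_p` at a place of degree one** (`e(v|p) = f(v|p) = 1` over `𝓞 ℚ`).
[cite: deShalit1987, II.1.1 (p. 32)] [cite: NeukirchANT1999, Ch. II Prop. (6.8)] -/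
def adicCompletionIntegersEquivPadicInt_of_degree_one (he : v.asIdeal.ramificationIdx (𝓞 ℚ) = 1)
    (hf : v.asIdeal.inertiaDeg (𝓞 ℚ) = 1) : v.adicCompletionIntegers F ≃+* ℤ_[p] :=
  adicCompletionIntegersEquivPadicInt p v hv (bijective_algebraMap_adicCompletionPadicAlgebra p v hv he hf)

/-- ★ **`𝒪_v ≃+* ℤ_p` at a split prime of a quadratic field**: for `F/ℚ` quadratic and two distinct places
`v ≠ w` above `p` (so `e = f = 1` at both) — the split prime `2 = 𝔭𝔭̄` of `ℚ(√−7)` of route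
`PrintCf2RubinValueTwo`: the `e : 𝒪_𝔭 ≃+* ℤ_2` of the measure side and of the Lubin–Tate tower files.
[cite: deShalit1987, II.1.1 (p. 32), I.3.3 (p. 17–18)] -/
def adicCompletionIntegersEquivPadicInt_of_split [Algebra.IsQuadraticExtension ℚ F]
    (w : HeightOneSpectrum (𝓞 F)) (hvw : v ≠ w) (hw : ((p : ℕ) : 𝓞 F) ∈ w.asIdeal) :
    v.adicCompletionIntegers F ≃+* ℤ_[p] :=
  adicCompletionIntegersEquivPadicInt p v hv (bijective_algebraMap_adicCompletionPadicAlgebra_of_split p v w hvw hv hw)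

end LocalField

end Literature.NumberTheory.GaloisRepresentations

end
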